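import Mathlib.RingTheory.PowerSeries.Inverse
import Mathlib.RingTheory.PowerSeries.Order
import Mathlib.RingTheory.LocalRing.ResidueField.Basic
import HarnessLib

/-!
# Power series over a local ring: a divisor with the same residual order is an associate
# (the algebraic hinge of the Wiles / Greenberg–Vatsal «one divisibility + equal Iwasawa invariants ⟹ equality» step)

Let `R` be a commutative local ring with residue field `k`, and write `f̄ ∈ k⟦X⟧` for the reduction of `f ∈ R⟦X⟧`.
For `g` with `ḡ ≠ 0` (equivalently: some coefficient of `g` is a unit — «unit content», Iwasawa `μ = 0` after the
content is divided out) the RESIDUAL ORDER `ord ḡ ∈ ℕ` is the Weierstrass degree (Iwasawa `λ`-invariant of `R⟦X⟧/(g)` when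
`R = ℤ_p`). The hinge:

* `isUnit_of_mul_eq_of_order_map_residue_eq` / `associated_of_dvd_of_order_map_residue_eq`: if `f ∣ g`, `ḡ ≠ 0` and
  `ord f̄ = ord ḡ`, then the cofactor is a unit, i.e. `f` and `g` are associated (`k⟦X⟧` is a domain, so
  `ord ḡ = ord f̄ + ord h̄` forces `ord h̄ = 0`, i.e. `h(0) ∉ 𝔪`, i.e. `h` is a unit of `R⟦X⟧`);
* `span_singleton_eq_of_dvd_of_order_map_residue_eq`: the same as an equality of principal ideals;
* `associated_of_dvd_of_eq_mul_of_order_map_residue_eq`: the `μ`-twisted form over a local DOMAIN — if `f = c·f₀`,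
  `g = c·g₀` with the SAME `c ≠ 0` (equal `μ`-parts), `f ∣ g`, `ḡ₀ ≠ 0` and `ord f̄₀ = ord ḡ₀` (equal `λ`), then `f ∼ g`;
* `order_map_residue_eq_of_associated`: conversely associates have the same residual order;
* `map_residue_ne_zero_iff_exists_isUnit_coeff`: `ḡ ≠ 0 ↔ ∃ n, IsUnit (coeff n g)` (= the tree's
  `GreenbergVatsal2000.HasUnitContent g`, stated here without that import).

This is the last step of Wiles's proof of the main conjecture («Theorem 1.2 … it is enough to prove one divisibility and
compare invariants», Ann. of Math. 131 (1990) §10), of Greenberg–Vatsal, Invent. Math. 142 (2000) Thm. (1.3)/(1.4), and of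
Castella–Grossi–Lee–Skinner, Invent. Math. 227 (2022) Thm. 3.2.1 («With equalities (alg-inv) and (an-inv) in hand … it suffices
to prove one of the predicted divisibilities»); it is pure commutative algebra and is recorded as folklore. It is the
«S2d hinge generalisation» asked for by critic idea-crit-10 V#17 on line `eisenstein-resource-bdp-line` of crux
stmt-BirchSwinnertonDyer-20372 (the `λ = 0` case `associated_of_dvd_of_constantCoeff` is in that skeleton), stated over an
arbitrary local ring so that it applies to `ℤ_p⟦T⟧`, `𝓞⟦T⟧` and `𝓞_{ℂ_p}⟦T⟧` alike. Nothing here is specific to BSD.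
-/

namespace Literature.RingTheory.PowerSeries

open _root_.PowerSeries _root_.IsLocalRing

variable {R : Type*} [CommRing R] [IsLocalRing R]

/-- Over a local ring, the reduction `ḡ ∈ k⟦X⟧` of a power series is non-zero iff some coefficient of `g` is a unit
(«unit content»; for `R = ℤ_p` this is `μ(g) = 0`). [cite: GreenbergVatsal2000, §1 p. 18, (1)–(2) (μ- and λ-invariant of a power series via Weierstrass preparation; unit-invariant)] -/
theorem map_residue_ne_zero_iff_exists_isUnit_coeff (g : R⟦X⟧) :
    PowerSeries.map (residue R) g ≠ 0 ↔ ∃ n : ℕ, IsUnit (coeff n g) := by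
  constructor
  · intro h
    by_contra hne
    simp only [not_exists] at hne
    apply h
    ext n
    rw [coeff_map, map_zero, residue_eq_zero_iff]
    exact (mem_maximalIdeal _).mpr (hne n)
  · rintro ⟨n, hn⟩ h
    have h' : residue R (coeff n g) = 0 := by
      rw [← coeff_map, h, map_zero]
    rw [residue_eq_zero_iff] at h'
    exact h' hn

/-- Units of `R⟦X⟧` reduce to power series of order `0`. [cite: GreenbergVatsal2000, §1 p. 18, (1)–(2) (μ- and λ-invariant of a power series via Weierstrass preparation; unit-invariant)] -/
theorem order_map_residue_eq_zero_of_isUnit {u : R⟦X⟧} (hu : IsUnit u) :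
    (PowerSeries.map (residue R) u).order = 0 :=
  order_zero_of_unit (hu.map _)

/-- Associates have the same residual order (the `λ`-invariant is an invariant of the principal ideal). [cite: GreenbergVatsal2000, §1 p. 18, (1)–(2) (μ- and λ-invariant of a power series via Weierstrass preparation; unit-invariant)] -/
theorem order_map_residue_eq_of_associated {f g : R⟦X⟧} (h : Associated f g) :
    (PowerSeries.map (residue R) f).order = (PowerSeries.map (residue R) g).order := by
  obtain ⟨u, rfl⟩ := h
  rw [map_mul, order_mul, order_map_residue_eq_zero_of_isUnit u.isUnit, add_zero]

/-- **The hinge (cofactor form).** If `f * h = g` in `R⟦X⟧` over a local ring, the reduction of `g` is non-zero and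
`f`, `g` have the same residual order, then `h` is a unit. [cite: CastellaGrossiLeeSkinner2022, proof of Thm. 5.1.1 (arXiv:2008.02571 p. 23: «This divisibility, together with the equalities … λ(X_E) = λ(L_E) …, yields the result»)] -/
theorem isUnit_of_mul_eq_of_order_map_residue_eq {f g h : R⟦X⟧} (hfh : f * h = g)
    (hg : PowerSeries.map (residue R) g ≠ 0)
    (hord : (PowerSeries.map (residue R) f).order = (PowerSeries.map (residue R) g).order) : IsUnit h := by
  have hmul : PowerSeries.map (residue R) f * PowerSeries.map (residue R) h = PowerSeries.map (residue R) g := by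
    rw [← map_mul, hfh]
  have hsum : (PowerSeries.map (residue R) g).order =
      (PowerSeries.map (residue R) f).order + (PowerSeries.map (residue R) h).order := by
    rw [← hmul, order_mul]
  have hgfin : (PowerSeries.map (residue R) g).order ≠ ⊤ := order_eq_top.not.mpr hg
  obtain ⟨a, ha⟩ := ENat.ne_top_iff_exists.mp hgfin
  have hh0 : (PowerSeries.map (residue R) h).order = 0 := by
    rcases ENat.ne_top_iff_exists.mp (show (PowerSeries.map (residue R) h).order ≠ ⊤ by
      intro htop; rw [htop, add_top] at hsum; exact hgfin hsum) with ⟨b, hb⟩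
    rw [← hb] at hsum ⊢
    rw [hord, ← ha, ← Nat.cast_add] at hsum
    have hab : a = a + b := by exact_mod_cast hsum
    have hb0 : b = 0 := by omega
    simp [hb0]
  have hc : coeff 0 (PowerSeries.map (residue R) h) ≠ 0 := (order_eq_nat.mp hh0).1
  rw [coeff_map, coeff_zero_eq_constantCoeff] at hc
  have hunit : IsUnit (constantCoeff h) := by
    by_contra hnu
    exact hc ((residue_eq_zero_iff _).mpr ((mem_maximalIdeal _).mpr hnu))
  exact isUnit_iff_constantCoeff.mpr hunit

/-- **The hinge (divisibility form): a divisor with the same residual order is an associate.** If `f ∣ g` in `R⟦X⟧`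
over a local ring, `ḡ ≠ 0` and `ord f̄ = ord ḡ`, then `Associated f g`. For `R` a DVR / `ℤ_p`: «`Q ∣ C`, `μ(Q) = μ(C) = 0`,
`λ(Q) = λ(C)` ⟹ `(Q) = (C)`». [cite: CastellaGrossiLeeSkinner2022, proof of Thm. 5.1.1 (arXiv:2008.02571 p. 23: «This divisibility, together with the equalities … λ(X_E) = λ(L_E) …, yields the result»)] [cite: GreenbergVatsal2000, §1 p. 18, (1)–(2) (μ- and λ-invariant of a power series via Weierstrass preparation; unit-invariant)] -/
theorem associated_of_dvd_of_order_map_residue_eq {f g : R⟦X⟧} (hfg : f ∣ g)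
    (hg : PowerSeries.map (residue R) g ≠ 0)
    (hord : (PowerSeries.map (residue R) f).order = (PowerSeries.map (residue R) g).order) : Associated f g := by
  obtain ⟨h, rfl⟩ := hfg
  exact ⟨(isUnit_of_mul_eq_of_order_map_residue_eq rfl hg hord).unit, by simp⟩

/-- The hinge as an equality of principal ideals. [cite: CastellaGrossiLeeSkinner2022, proof of Thm. 5.1.1 (arXiv:2008.02571 p. 23: «This divisibility, together with the equalities … λ(X_E) = λ(L_E) …, yields the result»)] -/
theorem span_singleton_eq_of_dvd_of_order_map_residue_eq {f g : R⟦X⟧} (hfg : f ∣ g)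
    (hg : PowerSeries.map (residue R) g ≠ 0)
    (hord : (PowerSeries.map (residue R) f).order = (PowerSeries.map (residue R) g).order) :
    Ideal.span {f} = Ideal.span {g} :=
  le_antisymm
    (Ideal.span_singleton_le_span_singleton.mpr (associated_of_dvd_of_order_map_residue_eq hfg hg hord).symm.dvd)
    (Ideal.span_singleton_le_span_singleton.mpr hfg)

/-- The same, with the divisibility given as the inclusion of principal ideals `(g) ≤ (f)` and the conclusion as the
reverse inclusion `(f) ≤ (g)` — the shape of the «upgrade» stubs. [cite: CastellaGrossiLeeSkinner2022, proof of Thm. 5.1.1 (arXiv:2008.02571 p. 23: «This divisibility, together with the equalities … λ(X_E) = λ(L_E) …, yields the result»)] -/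
theorem span_singleton_le_of_le_of_order_map_residue_eq {f g : R⟦X⟧} (hle : Ideal.span {g} ≤ Ideal.span {f})
    (hg : PowerSeries.map (residue R) g ≠ 0)
    (hord : (PowerSeries.map (residue R) f).order = (PowerSeries.map (residue R) g).order) :
    Ideal.span {f} ≤ Ideal.span {g} :=
  (span_singleton_eq_of_dvd_of_order_map_residue_eq (Ideal.span_singleton_le_span_singleton.mp hle) hg hord).le

/-- **`μ`-twisted form over a local domain (equal `μ` AND equal `λ`).** If `f = c·f₀` and `g = c·g₀` with the same
`c ≠ 0` (e.g. `c = ϖ^μ`), `f ∣ g`, `ḡ₀ ≠ 0` and `ord f̄₀ = ord ḡ₀`, then `Associated f g`. [cite: CastellaGrossiLeeSkinner2022, proof of Thm. 5.1.1 (arXiv:2008.02571 p. 23: «This divisibility, together with the equalities … λ(X_E) = λ(L_E) …, yields the result»)] [cite: GreenbergVatsal2000, §1 p. 18, (1)–(2) (μ- and λ-invariant of a power series via Weierstrass preparation; unit-invariant)] -/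
theorem associated_of_dvd_of_eq_mul_of_order_map_residue_eq [IsDomain R] {f g f₀ g₀ c : R⟦X⟧} (hc : c ≠ 0)
    (hf : f = c * f₀) (hg : g = c * g₀) (hfg : f ∣ g)
    (hg₀ : PowerSeries.map (residue R) g₀ ≠ 0)
    (hord : (PowerSeries.map (residue R) f₀).order = (PowerSeries.map (residue R) g₀).order) : Associated f g := by
  obtain ⟨h, hh⟩ := hfg
  have hfg₀ : f₀ * h = g₀ := by
    apply mul_left_cancel₀ hc
    rw [← mul_assoc, ← hf, ← hh, hg]
  have hu : IsUnit h := isUnit_of_mul_eq_of_order_map_residue_eq hfg₀ hg₀ hord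
  exact ⟨hu.unit, by rw [hh]; simp⟩

/-- **`μ`-twisted form as principal-ideal inclusions** (the exact shape of a «one inclusion ⟹ the reverse inclusion» upgrade
stub over `𝓞⟦T⟧` / `𝓞_{ℂ_p}⟦T⟧`): for an ideal `I = (C)` with `I ≤ (Q)`, common `μ`-part `c ≠ 0` (`C = c·C₀`, `Q = c·Q₀`),
`C̄₀ ≠ 0` and `ord Q̄₀ = ord C̄₀`, the reverse inclusion `(Q) ≤ I` holds. [cite: CastellaGrossiLeeSkinner2022, proof of Thm. 5.1.1 (arXiv:2008.02571 p. 23: «This divisibility, together with the equalities … λ(X_E) = λ(L_E) …, yields the result»)] [cite: GreenbergVatsal2000, §1 p. 18, (1)–(2) (μ- and λ-invariant of a power series via Weierstrass preparation; unit-invariant)] -/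
theorem span_singleton_le_of_le_of_eq_mul_of_order_map_residue_eq [IsDomain R] {I : Ideal R⟦X⟧}
    {Q C c C₀ Q₀ : R⟦X⟧} (hI : I = Ideal.span {C}) (hle : I ≤ Ideal.span {Q}) (hc : c ≠ 0)
    (hC : C = c * C₀) (hQ : Q = c * Q₀) (hC₀ : PowerSeries.map (residue R) C₀ ≠ 0)
    (hord : (PowerSeries.map (residue R) Q₀).order = (PowerSeries.map (residue R) C₀).order) :
    Ideal.span {Q} ≤ I := by
  subst hI
  have hQC : Q ∣ C := Ideal.span_singleton_le_span_singleton.mp hle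
  exact Ideal.span_singleton_le_span_singleton.mpr
    (associated_of_dvd_of_eq_mul_of_order_map_residue_eq hc hQ hC hQC hC₀ hord).symm.dvd

/-- The untwisted principal-ideal form (`μ = 0` on the larger side): `I = (C) ≤ (Q)`, `C̄ ≠ 0`, `ord Q̄ = ord C̄` ⟹ `(Q) ≤ I`.
[cite: CastellaGrossiLeeSkinner2022, proof of Thm. 5.1.1 (arXiv:2008.02571 p. 23)] -/
theorem span_singleton_le_of_le_of_order_map_residue_eq' {I : Ideal R⟦X⟧} {Q C : R⟦X⟧} (hI : I = Ideal.span {C})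
    (hle : I ≤ Ideal.span {Q}) (hC : PowerSeries.map (residue R) C ≠ 0)
    (hord : (PowerSeries.map (residue R) Q).order = (PowerSeries.map (residue R) C).order) :
    Ideal.span {Q} ≤ I := by
  subst hI
  exact span_singleton_le_of_le_of_order_map_residue_eq hle hC hord

/-! ### Transport of the residual order along a ring map compatible with the maximal ideals
(e.g. `ℤ_p → 𝓞`, `ℤ_p → 𝓞_{ℂ_p}`: the `λ`-invariant of a power series does not change under extension of scalars) -/

section Transport

variable {S : Type*} [CommRing S] [IsLocalRing S]

/-- Two power series whose coefficients vanish at the same indices have the same order. [folklore] -/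
private theorem order_eq_order_of_coeff_eq_zero_iff {A B : Type*} [Semiring A] [Semiring B] {φ : A⟦X⟧} {ψ : B⟦X⟧}
    (h : ∀ n, coeff n φ = 0 ↔ coeff n ψ = 0) : φ.order = ψ.order := by
  exact le_antisymm (le_order _ _ fun i hi => (h i).mp (coeff_of_lt_order i hi))
    (le_order _ _ fun i hi => (h i).mpr (coeff_of_lt_order i hi))

/-- **Residual order is invariant under a ring map `J : R → S` of local rings that detects the maximal ideals**
(`J a ∈ 𝔪_S ↔ a ∈ 𝔪_R`; e.g. the structure maps `ℤ_p → 𝓞_L`, `ℤ_p → 𝓞_{ℂ_p}`): the reduction of `φ.map J` modulo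
`𝔪_S` has the same order as the reduction of `φ` modulo `𝔪_R`; in particular one is non-zero iff the other is. This is
the statement that the `λ`- (and `μ = 0`-) invariant of a power series is unchanged by extension of scalars.
[cite: GreenbergVatsal2000, §1 p. 18, (1)–(2) (μ, λ of a power series; independent of the coefficient ring)] -/
theorem order_map_residue_map_eq_of_mem_maximalIdeal_iff (J : R →+* S)
    (hJ : ∀ a : R, J a ∈ maximalIdeal S ↔ a ∈ maximalIdeal R) (φ : R⟦X⟧) :
    (PowerSeries.map (residue S) (PowerSeries.map J φ)).order = (PowerSeries.map (residue R) φ).order := by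
  refine order_eq_order_of_coeff_eq_zero_iff fun n => ?_
  rw [coeff_map, coeff_map, coeff_map, residue_eq_zero_iff, residue_eq_zero_iff]
  exact hJ _

/-- Same transport, non-vanishing form. [cite: GreenbergVatsal2000, §1 p. 18, (2)] -/
theorem map_residue_map_ne_zero_iff_of_mem_maximalIdeal_iff (J : R →+* S)
    (hJ : ∀ a : R, J a ∈ maximalIdeal S ↔ a ∈ maximalIdeal R) (φ : R⟦X⟧) :
    PowerSeries.map (residue S) (PowerSeries.map J φ) ≠ 0 ↔ PowerSeries.map (residue R) φ ≠ 0 := by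
  rw [Ne, Ne, ← order_eq_top, ← order_eq_top, order_map_residue_map_eq_of_mem_maximalIdeal_iff J hJ φ]

end Transport

/-! ### The generator-free «invariant match» of an ideal against a power series ⟺ a residual-order inequality
(`μ(I) = 0 ∧ λ(I) ≤ λ(Q)`; with the divisibility `Q ∣ G` it is the equality of invariants) -/

section Match

/-- If the coefficients of `Q` below `n` lie in the maximal ideal, the reduction `Q̄` has order `≥ n`
(«`λ(Q) ≥ n` or `μ(Q) > 0`»). [cite: GreenbergVatsal2000, §1 p. 18, (1)–(2) (μ- and λ-invariant of a power series)] -/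
theorem le_order_map_residue_of_coeff_mem_maximalIdeal {Q : R⟦X⟧} {n : ℕ}
    (hQ : ∀ m < n, coeff m Q ∈ maximalIdeal R) : (n : ℕ∞) ≤ (PowerSeries.map (residue R) Q).order :=
  nat_le_order _ n fun m hm => by rw [coeff_map, residue_eq_zero_iff]; exact hQ m hm

/-- Conversely, the coefficients below the residual order lie in the maximal ideal (the coefficients of a power series below its
`λ`-invariant are non-units). [cite: GreenbergVatsal2000, §1 p. 18, (1)–(2) (μ- and λ-invariant of a power series)] -/
theorem coeff_mem_maximalIdeal_of_lt_order_map_residue {Q : R⟦X⟧} {m : ℕ}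
    (hm : (m : ℕ∞) < (PowerSeries.map (residue R) Q).order) : coeff m Q ∈ maximalIdeal R := by
  rw [← residue_eq_zero_iff, ← coeff_map]
  exact coeff_of_lt_order m hm

/-- A unit coefficient in degree `n` makes the reduction non-zero of order `≤ n` («`μ = 0` and `λ ≤ n`»).
[cite: GreenbergVatsal2000, §1 p. 18, (1)–(2) (μ- and λ-invariant of a power series)] -/
theorem map_residue_ne_zero_and_order_le_of_isUnit_coeff {G : R⟦X⟧} {n : ℕ} (h : IsUnit (coeff n G)) :
    PowerSeries.map (residue R) G ≠ 0 ∧ (PowerSeries.map (residue R) G).order ≤ n := by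
  have hn : coeff n (PowerSeries.map (residue R) G) ≠ 0 := by
    rw [coeff_map, Ne, residue_eq_zero_iff]
    exact fun hmem => (mem_maximalIdeal _).mp hmem h
  exact ⟨fun h0 => hn (by rw [h0, map_zero]), order_le n hn⟩

/-- If the reduction has order exactly `n : ℕ`, the degree-`n` coefficient is a unit (the `λ`-th coefficient of a power series
with `μ = 0` is a unit). [cite: GreenbergVatsal2000, §1 p. 18, (1)–(2) (μ- and λ-invariant of a power series)] -/
theorem isUnit_coeff_of_order_map_residue_eq {G : R⟦X⟧} {n : ℕ}
    (h : (PowerSeries.map (residue R) G).order = n) : IsUnit (coeff n G) := by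
  have hc : coeff n (PowerSeries.map (residue R) G) ≠ 0 := (order_eq_nat.mp h).1
  rw [coeff_map] at hc
  by_contra hnu
  exact hc ((residue_eq_zero_iff _).mpr ((mem_maximalIdeal _).mpr hnu))

/-- **The generator-free «invariant match» ⟺ a residual-order inequality.** For an ideal `I` of `R⟦X⟧` over a local ring and
`Q ∈ R⟦X⟧` the following are equivalent: (i) for some `n`, the coefficients of `Q` below `n` are non-units and some `G ∈ I` has
a UNIT `n`-th coefficient; (ii) some `G ∈ I` has non-zero reduction `Ḡ` with `ord Ḡ ≤ ord Q̄`. For `R = ℤ_p`, `𝓞`, `𝓞_{ℂ_p}` and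
`I` a(n image) characteristic ideal, (ii) reads «`μ(I) = 0` and `λ(I) ≤ λ(Q)`» (`λ(Q) = ∞` when `μ(Q) > 0`): the Greenberg–Vatsal
comparison of invariants as an INEQUALITY — which, together with a divisibility `Q ∣ G` (`ord Q̄ ≤ ord Ḡ`), is the equality of
invariants of the «one divisibility + equal invariants» method.
[cite: GreenbergVatsal2000, §1 p. 18, (1)–(2) and Thm. (1.3) (μ, λ; equality of invariants + one divisibility)] -/
theorem exists_isUnit_coeff_match_iff_exists_order_map_residue_le (I : Ideal R⟦X⟧) (Q : R⟦X⟧) :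
    (∃ n : ℕ, (∀ m < n, coeff m Q ∈ maximalIdeal R) ∧ ∃ G ∈ I, IsUnit (coeff n G)) ↔
      ∃ G ∈ I, PowerSeries.map (residue R) G ≠ 0 ∧
        (PowerSeries.map (residue R) G).order ≤ (PowerSeries.map (residue R) Q).order := by
  constructor
  · rintro ⟨n, hQ, G, hGI, hGn⟩
    obtain ⟨hG0, hle⟩ := map_residue_ne_zero_and_order_le_of_isUnit_coeff hGn
    exact ⟨G, hGI, hG0, hle.trans (le_order_map_residue_of_coeff_mem_maximalIdeal hQ)⟩
  · rintro ⟨G, hGI, hG0, hle⟩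
    obtain ⟨n, hn⟩ := ENat.ne_top_iff_exists.mp (order_eq_top.not.mpr hG0)
    refine ⟨n, fun m hm => coeff_mem_maximalIdeal_of_lt_order_map_residue (lt_of_lt_of_le ?_ hle), G, hGI,
      isUnit_coeff_of_order_map_residue_eq hn.symm⟩
    rw [← hn]
    exact_mod_cast hm

/-- **The match from the two comparisons through a common bound** («`λ(I) ≤ N`, `μ(I) = 0`» on the module side and
«`N ≤ λ(Q)`» on the analytic side; in the Greenberg–Vatsal / Castella–Grossi–Lee–Skinner setting `N = λ(χ) + λ(χ′)` is read on
the character side of `ρ̄^{ss} = χ ⊕ χ′`).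
[cite: CastellaGrossiLeeSkinner2022, Thm. 3.2.1 and proof of Thm. 5.1.1 (arXiv:2008.02571 pp. 4, 23)] -/
theorem exists_isUnit_coeff_match_of_order_le_of_le_order (I : Ideal R⟦X⟧) (Q : R⟦X⟧) {N : ℕ∞}
    (halg : ∃ G ∈ I, PowerSeries.map (residue R) G ≠ 0 ∧ (PowerSeries.map (residue R) G).order ≤ N)
    (han : N ≤ (PowerSeries.map (residue R) Q).order) :
    ∃ n : ℕ, (∀ m < n, coeff m Q ∈ maximalIdeal R) ∧ ∃ G ∈ I, IsUnit (coeff n G) := by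
  obtain ⟨G, hGI, hG0, hle⟩ := halg
  exact (exists_isUnit_coeff_match_iff_exists_order_map_residue_le I Q).mpr ⟨G, hGI, hG0, hle.trans han⟩

/-- **Divisibility + match ⟹ EQUAL residual orders and associates.** If `I ≤ (Q)` and the match holds, the matching `G ∈ I`
satisfies `ord Ḡ = ord Q̄` and `Q ∼ G` (so `(Q) = (G) ≤ I`): the «upgrade».
[cite: CastellaGrossiLeeSkinner2022, proof of Thm. 5.1.1 (arXiv:2008.02571 p. 23)] -/
theorem exists_associated_of_le_span_of_match {I : Ideal R⟦X⟧} {Q : R⟦X⟧} (hI : I ≤ Ideal.span {Q})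
    (h : ∃ n : ℕ, (∀ m < n, coeff m Q ∈ maximalIdeal R) ∧ ∃ G ∈ I, IsUnit (coeff n G)) :
    ∃ G ∈ I, PowerSeries.map (residue R) G ≠ 0 ∧
      (PowerSeries.map (residue R) Q).order = (PowerSeries.map (residue R) G).order ∧ Associated Q G := by
  obtain ⟨G, hGI, hG0, hle⟩ := (exists_isUnit_coeff_match_iff_exists_order_map_residue_le I Q).mp h
  have hQG : Q ∣ G := Ideal.mem_span_singleton.mp (hI hGI)
  have hge : (PowerSeries.map (residue R) Q).order ≤ (PowerSeries.map (residue R) G).order := by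
    obtain ⟨c, rfl⟩ := hQG
    rw [map_mul]
    exact le_trans (by simp) (le_order_mul _ _)
  have hord : (PowerSeries.map (residue R) Q).order = (PowerSeries.map (residue R) G).order := le_antisymm hge hle
  exact ⟨G, hGI, hG0, hord, associated_of_dvd_of_order_map_residue_eq hQG hG0 hord⟩

/-- Against the UNIT ideal the match holds for every `Q` (`n = 0`, `G = 1`): it carries no information off the locus where
`I` is a genuine characteristic ideal (the characteristic ideal is the unit ideal off the torsion locus).
[cite: Washington1997, §13.2 (characteristic ideal of a torsion Λ-module; junk off torsion)] -/
theorem exists_isUnit_coeff_match_top (Q : R⟦X⟧) :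
    ∃ n : ℕ, (∀ m < n, coeff m Q ∈ maximalIdeal R) ∧ ∃ G ∈ (⊤ : Ideal R⟦X⟧), IsUnit (coeff n G) :=
  ⟨0, fun m hm => (Nat.not_lt_zero m hm).elim, 1, Submodule.mem_top, by
    rw [coeff_zero_eq_constantCoeff_apply, map_one]; exact isUnit_one⟩

/-- **If `Q` is a unit, the match against `I` holds iff `I = ⊤`** (`ord Q̄ = 0` forces `ord Ḡ = 0`, i.e. `G` is a unit of
`R⟦X⟧`). [cite: GreenbergVatsal2000, §1 p. 18, (1)–(2) (μ- and λ-invariant of a power series; unit-invariant)] -/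
theorem exists_isUnit_coeff_match_iff_eq_top_of_isUnit {I : Ideal R⟦X⟧} {Q : R⟦X⟧} (hQ : IsUnit Q) :
    (∃ n : ℕ, (∀ m < n, coeff m Q ∈ maximalIdeal R) ∧ ∃ G ∈ I, IsUnit (coeff n G)) ↔ I = ⊤ := by
  rw [exists_isUnit_coeff_match_iff_exists_order_map_residue_le, order_map_residue_eq_zero_of_isUnit hQ]
  constructor
  · rintro ⟨G, hGI, -, hle⟩
    have h0 : (PowerSeries.map (residue R) G).order = (0 : ℕ) := le_antisymm (by exact_mod_cast hle) bot_le
    have hu : IsUnit G := isUnit_iff_constantCoeff.mpr (by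
      rw [← coeff_zero_eq_constantCoeff_apply]; exact isUnit_coeff_of_order_map_residue_eq h0)
    exact I.eq_top_of_isUnit_mem hGI hu
  · rintro rfl
    refine ⟨1, Submodule.mem_top, ?_, ?_⟩
    · rw [map_one]; exact one_ne_zero
    · rw [map_one, order_one]

/-- Coefficientwise congruent power series have the same reduction (the form in which a congruence of `p`-adic `L`-functions
«modulo `𝔪`» is used). [cite: GreenbergVatsal2000, Thm. (1.3) and (17) (congruence of p-adic L-functions read modulo the maximal ideal)] -/
theorem map_residue_eq_of_forall_coeff_sub_mem {Q G : R⟦X⟧} (h : ∀ n, coeff n Q - coeff n G ∈ maximalIdeal R) :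
    PowerSeries.map (residue R) Q = PowerSeries.map (residue R) G := by
  ext n
  rw [coeff_map, coeff_map, ← sub_eq_zero, ← map_sub, residue_eq_zero_iff]
  exact h n

/-- **(an-inv) shape: a congruence `Q ≡ u·L₁·L₂ (mod 𝔪)` with `u` a unit gives `ord Q̄ = ord L̄₁ + ord L̄₂`** (`λ(Q) = λ(L₁) +
λ(L₂)` when the `μ`-invariants vanish) — the way the analytic invariants are read off a congruence of `p`-adic `L`-functions
with a product of two character `L`-functions. [cite: GreenbergVatsal2000, Thm. (1.3) and (17) (analytic invariants from the congruence with the product of two Kubota–Leopoldt functions)] -/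
theorem order_map_residue_eq_add_of_congr_unit_mul {Q u L₁ L₂ : R⟦X⟧} (hu : IsUnit u)
    (h : ∀ n, coeff n Q - coeff n (u * L₁ * L₂) ∈ maximalIdeal R) :
    (PowerSeries.map (residue R) Q).order =
      (PowerSeries.map (residue R) L₁).order + (PowerSeries.map (residue R) L₂).order := by
  rw [map_residue_eq_of_forall_coeff_sub_mem h, map_mul, map_mul, order_mul, order_mul,
    order_map_residue_eq_zero_of_isUnit hu, zero_add]

variable {S : Type*} [CommRing S] [IsLocalRing S] in
/-- **(alg-inv) transport**: an element `g ∈ I ≤ R⟦X⟧` with `ḡ ≠ 0`, read in `S⟦X⟧` along a ring map `J : R → S` detecting the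
maximal ideals, is an element of `I.map (PowerSeries.map J)` with non-zero reduction of the SAME order (e.g. a characteristic
power series `g ∈ ℤ_p⟦T⟧` with `μ = 0`, `λ = ord ḡ`, read in `𝓞_{ℂ_p}⟦T⟧`).
[cite: GreenbergVatsal2000, §1 p. 18, (1)–(2) (μ, λ of a power series; independent of the coefficient ring)] -/
theorem exists_mem_map_map_residue_ne_zero_and_order_eq (J : R →+* S)
    (hJ : ∀ a : R, J a ∈ maximalIdeal S ↔ a ∈ maximalIdeal R) {I : Ideal R⟦X⟧} {g : R⟦X⟧} (hg : g ∈ I)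
    (hg0 : PowerSeries.map (residue R) g ≠ 0) :
    ∃ G ∈ I.map (PowerSeries.map J), PowerSeries.map (residue S) G ≠ 0 ∧
      (PowerSeries.map (residue S) G).order = (PowerSeries.map (residue R) g).order :=
  ⟨PowerSeries.map J g, Ideal.mem_map_of_mem _ hg,
    (map_residue_map_ne_zero_iff_of_mem_maximalIdeal_iff J hJ g).mpr hg0,
    order_map_residue_map_eq_of_mem_maximalIdeal_iff J hJ g⟩

end Match

end Literature.RingTheory.PowerSeries
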